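import Summits.ValiantsHypothesis.ValiantsHypothesis.Theorems.BarrierLeverPartitionMinorsHitByVPSamePatternDefs

/-!
# Route BarrierLever — item `PartitionMinorsHitByVP` (stmt-ValiantsHypothesis-19717):
# the Moore matrix of «down-closed rows × arbitrary column data» (one definition)

Helper file (`--supports stmt-ValiantsHypothesis-19717`; cell valiant-natproofs, rung V4, 𝒟-side door (c); prover
seat val-np-p6 gen 6). ONE DEFINITION; the peel step for it (the JOINT PEEL: down-closed rows, tie-free lowest digit on
the column side) is in the definition-free companion `…HitByVPJointPeel`.

* `colMatrix p n k d R W = [η_S ^ (Σ_{c ∈ W T} p^{d c})]_{S, T ∈ Fam R}` — rows = the members of a set family `R` over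
  `Fin n` read as NODE sets; the column indexed by `T` carries an arbitrary DIGIT set `W T ⊆ Fin k` with exponent map
  `d : Fin k → ℕ` (so the matrix is square by construction; `W` injective in applications). `spMatrix` of
  `…SamePatternDefs` is the case `k = n`, `W T = T` (`spMatrix_eq_colMatrix`).

WHAT THIS IS NOT: no theorem about item 19717 here; nothing on crux 14610 or VP vs VNP.
-/

set_option linter.dupNamespace false

namespace Summit.ValiantsHypothesis.ValiantsHypothesis.Theorems.BarrierLever.FrobeniusDoor

open Finset MvPolynomial Matrix

noncomputable section

variable (p : ℕ)

/-- The Moore matrix of «rows = members of `R` (node sets) × columns carrying the digit sets `W T`». -/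
def colMatrix (n k : ℕ) (d : Fin k → ℕ) (R : Finset (Finset (Fin n))) (W : Fam R → Finset (Fin k)) :
    Matrix (Fam R) (Fam R) (MvPolynomial (Fin (n + 1)) (ZMod p)) :=
  Matrix.of fun S T => ballEta p n S.1 ^ ballWt p k d (W T)

/-- `spMatrix` is the `colMatrix` with `W T = T`. -/
theorem spMatrix_eq_colMatrix (n : ℕ) (d : Fin n → ℕ) (F : Finset (Finset (Fin n))) :
    spMatrix p n d F = colMatrix p n n d F (fun T => T.1) := rfl

end

end Summit.ValiantsHypothesis.ValiantsHypothesis.Theorems.BarrierLever.FrobeniusDoor
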